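import Literature.AlgebraicGeometry.Frobenioids.MonoidFunctors
import Literature.AlgebraicGeometry.Frobenioids.ModelFrobenioidPreFrobenioid
import Literature.AnabelianGeometry.EtaleTheta.TemperedFrobenioidToy
import Literature.AnabelianGeometry.EtaleTheta.TemperedFrobenioidCnst
import Literature.AnabelianGeometry.EtaleTheta.Discharge.Sec3Thm37

/-!
# [EtTh] Remark 3.6.3 is NOT derivable over the typed Definition 3.3 (iii) / 3.6 (i)–(ii) data:
# inverse-closure of `F₀^Λ` is the exact missing input (kernel certificate)

S. Mochizuki, *The étale theta function …*, Publ. RIMS **45** (2009) [MochizukiEtTh2009], Def. 3.6 (iv) /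
Rmk. 3.6.3, PDF pp.78–79: "the natural functor `C^{bs-fld} → C` is isomorphism-full".  The proof-only file
`Discharge/Sec3Remark363.lean` (this seat) proves the named `Prop` `TemperedFrobenioid.Remark363` for every
tempered Frobenioid with sharp divisor monoids GIVEN the Prop. 3.4 (ii) constancy clause `hP34Λ` (the typed
field `RealifiedDivisorMonoids.Prop34Cnst.mem_FΛ_of_divΛ_eq_of`) and `hFinv` — "`F₀^Λ(Y) ⊆ B₀^Λ(Y)` is closed
under inverses" (print: `L^× ⥲ F₀(Y)`, Prop. 3.4 (ii) third isomorphism p.74; `F₀^ℚ = F₀^pf`,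
`F₀^ℝ = ℝ·Φ₀^cnst`, Def. 3.6 (i) p.76 — a group in all three cases), cell GAP-LEDGER row G-w5d135-1.

This file certifies in the kernel that `hFinv` cannot be dropped: over the trivial [FrdI] vocabularies
(`Toy.monoidVocab`, `Toy.catVocab` of `TemperedFrobenioidToy.lean`) it builds Def. 3.6 (i) data
`ToyFinv.realified` — `Φ₀ = Φ₀^ℝ = ℕ` (one prime `𝔭`), `B₀^Λ := (Φ₀^ℝ)^gp ≅ ℤ` with `Div = id`, and
`F₀^Λ := ` the EFFECTIVE classes `{𝔭ⁿ : n ≥ 0}` (a submonoid that is not a subgroup), `ℝ·Φ₀^cnst = ` everything —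
and the tempered-Frobenioid interface `ToyFinv.temperedFrobenioid` over it (`D = D₀` the one-object category,
`Φ = Φ^{ℝ-log}`), such that:
* every typed field holds (it is an inhabitant), the divisor monoids are sharp (`isSharp_divisorMonoid`),
  and the FULL typed Prop. 3.4 (ii) structure `Prop34Cnst` holds for the constant-field functor `cnst = 𝟭`
  (`prop34Cnst`; its constancy clause `hP34Λ` is `⟨x, rfl⟩`);
* `hFinv` FAILS (`not_hFinv`: `𝔭 ∈ F₀^Λ` has no inverse in `F₀^Λ`);
* `C^{bs-fld} → C` is NOT isomorphism-full (`not_isIsomorphismFull_hull`): the isomorphism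
  `hull(A, 0) ⥲ hull(A, 𝔭)` of `C` with unit `(𝔭⁻¹, 𝔭⁻¹)` has no lift, since a lift would have a unit with
  `B₀^Λ`-component `𝔭⁻¹ ∈ F₀^Λ`; hence `¬ Remark363` (`not_remark363`).
So the universal closure of the named fact `Remark363` over `RealifiedDivisorMonoids` + `Prop34Cnst` (+ sharp
`Φ`) is REFUTED, and `Sec3Remark363.remark363_of_isSharp`'s binder `hFinv` is necessary (`hFinv_necessary`).
HONEST FRAMING: a statement about the cell's typed INTERFACES (which printed property they omit), not about
the tempered Frobenioids of a curve, for which `F₀(Y) ≅ L^×` is a group and Rmk. 3.6.3 is not in doubt;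
refereed pre-IUT material; nothing here bears on [IUTchIII] Cor. 3.12.
-/

noncomputable section

namespace Literature.AnabelianGeometry.EtaleTheta

open CategoryTheory Opposite Literature.AlgebraicGeometry.Frobenioids

namespace ToyFinv

/-- `gpMap id = id`, pointwise. [folklore] -/
private theorem gpMap_id_apply {M : Type} [CommMonoid M] (x : Algebra.GrothendieckGroup M) :
    gpMap (MonoidHom.id M) x = x :=
  DFunLike.congr_fun (Literature.AlgebraicGeometry.Frobenioids.gpMap_id (M := M)) x

/-- The one prime `𝔭 = 1 ∈ ℕ` (additively) of `Φ₀ = ℕ`. [cite: MochizukiEtTh2009, Def 3.3 p.73] -/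
def prime : Multiplicative ℕ := Multiplicative.ofAdd 1

/-- `𝔭 ≠ 0`. [cite: MochizukiEtTh2009, Def 3.3 p.73] -/
theorem prime_ne_one : prime ≠ 1 := fun h => Nat.one_ne_zero (Multiplicative.ofAdd.injective h)

/-- `F₀^Λ := ` the effective classes `{𝔭ⁿ : n ≥ 0} ⊆ B₀^Λ := (Φ₀^ℝ)^gp ≅ ℤ` — the image of `Φ₀^ℝ = ℕ`; a submonoid,
NOT a subgroup. [cite: MochizukiEtTh2009, Def 3.6 p.76] -/
def effective : Submonoid (Algebra.GrothendieckGroup (Multiplicative ℕ)) :=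
  MonoidHom.mrange (Algebra.GrothendieckGroup.of (M := Multiplicative ℕ))

/-- `𝔭⁻¹ ∉ F₀^Λ`: a class that is both effective and anti-effective is trivial (`ℕ` is cancellative and
sharp). [cite: MochizukiEtTh2009, Def 3.6 p.76] -/
theorem inv_of_prime_not_mem : (Algebra.GrothendieckGroup.of prime)⁻¹ ∉ effective := by
  rintro ⟨y, hy⟩
  have h : Algebra.GrothendieckGroup.of (M := Multiplicative ℕ) (y * prime) = 1 := by
    rw [map_mul, hy, inv_mul_cancel]
  rw [← (Algebra.GrothendieckGroup.of (M := Multiplicative ℕ)).map_one] at h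
  have h' : y * prime = 1 := Algebra.GrothendieckGroup.of_injective h
  have h'' : Multiplicative.toAdd y + 1 = 0 := congrArg Multiplicative.toAdd h'
  omega

/-- **Def 3.6 (i) data of the certificate** (`Λ = ℤ`; `Φ₀^ℝ = Φ₀ = ℕ`, `B₀^Λ := (Φ₀^ℝ)^gp` with `Div = id`,
`F₀^Λ := ` effective classes, `ℝ·Φ₀^cnst = ` everything), on top of the Def 3.3 (iii) data of
`TemperedFrobenioidToy`. [cite: MochizukiEtTh2009, Def 3.6 p.76] -/
def realified : RealifiedDivisorMonoids (D₀ := Discrete PUnit.{1}) Toy.monoidVocab where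
  toDivisorMonoids := Toy.divisorMonoids
  Λ := MonoidType.Z
  ΦR := (Functor.const _).obj (CommMonCat.of (Multiplicative ℕ))
  toR _ := MonoidHom.id _
  toR_natural _ _ := rfl
  isRealification _ := trivial
  BΛ := (Functor.const _).obj (CommMonCat.of (Algebra.GrothendieckGroup (Multiplicative ℕ)))
  isUnit_BΛ _ b := by
    change IsUnit (M := Algebra.GrothendieckGroup (Multiplicative ℕ)) b
    exact Group.isUnit _
  divΛ _ := MonoidHom.id _
  divΛ_natural _ b := (gpMap_id_apply b).symm
  FΛ _ := effective
  FΛ_map _ _ hb := hb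
  cnstR _ := ⊤
  cnstR_map _ _ _ := trivial
  divΛ_mem_cnstR _ _ _ := trivial
  cnstR_root _ _ _ _ := trivial
  cnst_le_cnstR _ _ _ := trivial
  ncspR _ := ⊤
  cspR _ := ⊥
  toR_ncsp _ _ _ := trivial
  toR_csp _ _ hx := hx

/-- **Def 3.6 (ii) over the certificate data**: `D = D₀`, `Φ = Φ^{ℝ-log} = ℕ` (group-saturated trivially,
`Φ^{bs-fld} = ℕ` monoprime), and condition (b) witnessed by the constant `𝔭 ∈ F₀^Λ` with divisor `𝔭 ≠ 0`.
[cite: MochizukiEtTh2009, Def 3.6 p.77] -/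
def temperedFrobenioid : TemperedFrobenioid realified (Discrete PUnit.{1}) Toy.catVocab where
  isConnected := zigzag_isConnected fun j₁ j₂ => by rw [Subsingleton.elim j₁ j₂]
  isTotallyEpimorphic := ⟨fun f => ⟨fun _ _ _ => Subsingleton.elim _ _⟩⟩
  base := 𝟭 _
  Φ := ⟨fun _ => ⊤, fun _ _ _ => trivial⟩
  isGroupSaturated A := (isGroupSaturated_iff' _).2 fun _ _ _ _ _ _ => trivial
  isPerfFactorial _ := trivial
  isDivisorialOn := trivial
  isMonoprime_bsFld A := Toy.isMonoprime_of_eq_top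
    (eq_top_iff.2 fun x _ => Submonoid.mem_inf.2 ⟨Submonoid.mem_top x,
      (Subgroup.mem_top (Algebra.GrothendieckGroup.of x) :
        Algebra.GrothendieckGroup.of x ∈ (⊤ : Subgroup (Algebra.GrothendieckGroup (Multiplicative ℕ))))⟩)
  exists_FΛ_div_ne A := ⟨Algebra.GrothendieckGroup.of prime, ⟨prime, rfl⟩, prime, trivial, 1, trivial,
    prime_ne_one, by
      change Algebra.GrothendieckGroup.of (M := Multiplicative ℕ) prime =
        Algebra.GrothendieckGroup.of (M := Multiplicative ℕ) prime /
          Algebra.GrothendieckGroup.of (M := Multiplicative ℕ) 1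
      rw [(Algebra.GrothendieckGroup.of (M := Multiplicative ℕ)).map_one, div_one]⟩

/-- The divisor monoids `Φ(A) = ℕ` of the certificate are sharp (so the failure below is not an artefact of
units of `Φ`). [cite: MochizukiEtTh2009, Def 3.6 p.77] -/
theorem isSharp_divisorMonoid (A : Discrete PUnit.{1}) :
    IsSharp (temperedFrobenioid.divisorMonoid.obj (op A)) := by
  refine ⟨fun a ha => ?_⟩
  have ha' : IsUnit (M := Multiplicative ℕ) (Subtype.val a) :=
    ha.map (temperedFrobenioid.Φ.carrier (op A)).subtype
  have h1 : Subtype.val a = (1 : Multiplicative ℕ) := by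
    obtain ⟨u, hu⟩ := ha'
    have hv : Multiplicative.toAdd (u : Multiplicative ℕ) +
        Multiplicative.toAdd (↑u⁻¹ : Multiplicative ℕ) = 0 :=
      congrArg Multiplicative.toAdd u.mul_inv
    have h0 : Multiplicative.toAdd (u : Multiplicative ℕ) = 0 := by omega
    rw [← hu]
    exact congrArg Multiplicative.ofAdd h0
  exact Subtype.ext h1

/-- **The typed Prop 3.4 (ii) structure holds for the certificate** (with `D^cnst := D₀`, `cnst := 𝟭`): the
constancy clause `hP34Λ` is `⟨x, rfl⟩` (`F₀^Λ` IS the effective locus), the naturality clauses are identities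
of constant functors, and the faithfulness clause is trivial on the one-object base.
[cite: MochizukiEtTh2009, Prop 3.4 (ii) p.74] -/
theorem prop34Cnst : realified.Prop34Cnst (𝟭 (Discrete PUnit.{1})) where
  mem_FΛ_of_divΛ_eq_of _ _ x h := ⟨x, h.symm⟩
  BΛ_map_eq_of_cnst_map_eq _ _ _ _ _ := rfl
  ΦR_map_eq_of_cnst_map_eq _ _ _ _ _ := rfl
  cnst_map_eq_of_BΛ_map_eq _ _ _ _ _ := Subsingleton.elim _ _

/-- `Φ₀^ℝ(Y) = ℕ` is integral (cancellative) — the binder `hInt` of `Sec3Def36NonzeroConstants` also holds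
here. [cite: MochizukiEtTh2009, Def 3.6 p.76] -/
theorem hInt (Y : (Discrete PUnit.{1})ᵒᵖ) : IsCancelMul (realified.ΦR.obj Y) :=
  (inferInstance : IsCancelMul (Multiplicative ℕ))

/-- **`hFinv` FAILS for the certificate**: `𝔭 ∈ F₀^Λ` has no inverse in `F₀^Λ`.
[cite: MochizukiEtTh2009, Def 3.6 p.76] -/
theorem not_hFinv :
    ¬ ∀ (Y : (Discrete PUnit.{1})ᵒᵖ) (b : realified.BΛ.obj Y), b ∈ realified.FΛ Y →
      ∃ b' ∈ realified.FΛ Y, b' * b = 1 := by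
  intro h
  obtain ⟨b', ⟨y, hy⟩, hb'⟩ := h (op ⟨⟨⟩⟩) (Algebra.GrothendieckGroup.of prime) ⟨prime, rfl⟩
  have h1 : Algebra.GrothendieckGroup.of (M := Multiplicative ℕ) (y * prime) =
      Algebra.GrothendieckGroup.of (M := Multiplicative ℕ) 1 := by
    rw [map_mul, map_one, hy]
    exact hb'
  have h2 : Multiplicative.toAdd y + 1 = 0 :=
    congrArg Multiplicative.toAdd (Algebra.GrothendieckGroup.of_injective h1)
  omega

/-! ## The isomorphism of `C` that does not lift -/

/-- The object `A` of the one-object base category. [cite: MochizukiEtTh2009, Def 3.6 p.77] -/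
def baseObj : Discrete PUnit.{1} := ⟨⟨⟩⟩

/-- `𝔭` as an element of `Φ(A) = ℕ`. [cite: MochizukiEtTh2009, Def 3.6 p.77] -/
def primeΦ : temperedFrobenioid.Φ.carrier (op baseObj) := ⟨prime, trivial⟩

/-- `𝔭` as an element of `Φ^{bs-fld}(A) = ℕ`. [cite: MochizukiEtTh2009, Def 3.6 p.77] -/
def primeBs : temperedFrobenioid.bsFld.carrier (op baseObj) := ⟨prime, trivial, trivial⟩

/-- The object `(A, 0)` of `C^{bs-fld}`. [cite: MochizukiEtTh2009, Def 3.6 p.78] -/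
def X₀ : temperedFrobenioid.hullCategory := ⟨baseObj, 1⟩

/-- The object `(A, 𝔭)` of `C^{bs-fld}`. [cite: MochizukiEtTh2009, Def 3.6 p.78] -/
def X₁ : temperedFrobenioid.hullCategory := ⟨baseObj, Algebra.GrothendieckGroup.of primeBs⟩

/-- `(Φ^gp → (Φ^{ℝ-log})^gp)(𝔭) = 𝔭`. [cite: MochizukiEtTh2009, Def 3.6 p.77] -/
theorem ΦgpToRlog_of_primeΦ :
    temperedFrobenioid.ΦgpToRlog (op baseObj)
        (Algebra.GrothendieckGroup.of (M := temperedFrobenioid.divisorMonoid.obj (op baseObj)) primeΦ) =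
      Algebra.GrothendieckGroup.of prime :=
  gpMap_of _ _

/-- The class `𝔭⁻¹ ∈ B₀^Λ = (Φ₀^ℝ)^gp`. [cite: MochizukiEtTh2009, Def 3.6 p.76] -/
def invPrimeB : realified.BΛ.obj (temperedFrobenioid.baseOp (op baseObj)) :=
  ((Algebra.GrothendieckGroup.of prime)⁻¹ : Algebra.GrothendieckGroup (Multiplicative ℕ))

/-- `𝔭⁻¹ ∉ F₀^Λ` (restated for `invPrimeB`). [cite: MochizukiEtTh2009, Def 3.6 p.76] -/
theorem invPrimeB_not_mem : invPrimeB ∉ effective := inv_of_prime_not_mem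

/-- The unit `(𝔭⁻¹, 𝔭⁻¹) ∈ B(A) = B₀^Λ ×_{(Φ^{ℝ-log})^gp} Φ^gp` — a NON-constant rational function (its
`B₀^Λ`-component is anti-effective, `∉ F₀^Λ`). [cite: MochizukiEtTh2009, Def 3.6 p.77] -/
def badUnit : temperedFrobenioid.ratFnFunctor.obj (op baseObj) :=
  ⟨(invPrimeB,
    (Algebra.GrothendieckGroup.of (M := temperedFrobenioid.divisorMonoid.obj (op baseObj)) primeΦ)⁻¹), by
    show realified.divΛ (temperedFrobenioid.baseOp (op baseObj)) invPrimeB =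
      temperedFrobenioid.ΦgpToRlog (op baseObj)
        (Algebra.GrothendieckGroup.of (M := temperedFrobenioid.divisorMonoid.obj (op baseObj)) primeΦ)⁻¹
    rw [map_inv, ΦgpToRlog_of_primeΦ]
    rfl⟩

/-- The morphism `(1, id, 0, (𝔭⁻¹, 𝔭⁻¹)) : hull(A, 0) → hull(A, 𝔭)` of `C` (relation (d): `0 + 0 = 𝔭 + (−𝔭)`).
[cite: MochizukiEtTh2009, Rmk 3.6.3 p.79] -/
def badHom : temperedFrobenioid.hull.obj X₀ ⟶ temperedFrobenioid.hull.obj X₁ :=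
  ModelFrobenioid.mkHom _ _ 1 (𝟙 baseObj) 1 badUnit (by
    show temperedFrobenioid.bsFldInclGpM (op baseObj) 1 ^ ((1 : ℕ+) : ℕ) *
        Algebra.GrothendieckGroup.of (1 : temperedFrobenioid.divisorMonoid.obj (op baseObj)) =
      pullGp temperedFrobenioid.divisorMonoid (𝟙 baseObj)
          (temperedFrobenioid.bsFldInclGpM (op baseObj) (Algebra.GrothendieckGroup.of primeBs)) *
        (Algebra.GrothendieckGroup.of (M := temperedFrobenioid.divisorMonoid.obj (op baseObj)) primeΦ)⁻¹
    rw [PNat.one_coe, pow_one, map_one, map_one, one_mul, pullGp_id, TemperedFrobenioid.bsFldInclGpM_of,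
      eq_comm, mul_inv_eq_one]
    rfl)

/-- `badHom` is an isomorphism of `C` ([FrdI] Thm 5.2 (ii): degree `1`, base-isomorphism, trivial divisor,
`B` group-like). [cite: MochizukiEtTh2009, Rmk 3.6.3 p.79] -/
theorem isIso_badHom : IsIso badHom := by
  haveI : IsIso (ModelFrobenioid.baseMap badHom) := by
    change IsIso (𝟙 baseObj)
    infer_instance
  exact ModelFrobenioid.isIso_of (temperedFrobenioid.ratFnFunctor_isGroupLike realified.isUnit_BΛ)
    badHom rfl rfl

/-- **`C^{bs-fld} → C` is NOT isomorphism-full for the certificate**: the isomorphism `badHom` does not lift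
(a lift's unit would have `B₀^Λ`-component `𝔭⁻¹ ∈ F₀^Λ`). [cite: MochizukiEtTh2009, Rmk 3.6.3 p.79] -/
theorem not_isIsomorphismFull_hull : ¬ IsIsomorphismFull temperedFrobenioid.hull := by
  intro h
  haveI := isIso_badHom
  obtain ⟨f, hf⟩ := h.exists_mapIso_eq X₀ X₁ (asIso badHom)
  have h1 : (Subtype.val (ModelFrobenioid.unit f.hom)).1 = invPrimeB := by
    have h2 := congrArg (fun e : temperedFrobenioid.hull.obj X₀ ≅ temperedFrobenioid.hull.obj X₁ =>
      (Subtype.val (ModelFrobenioid.unit e.hom)).1) hf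
    exact h2
  have hmem : (Subtype.val (ModelFrobenioid.unit f.hom)).1 ∈ effective := (ModelFrobenioid.unit f.hom).2.1
  rw [h1] at hmem
  exact invPrimeB_not_mem hmem

/-- **[EtTh] Remark 3.6.3 FAILS for the certificate** (although every typed field, sharpness of `Φ` and the
typed Prop 3.4 (ii) structure hold). [cite: MochizukiEtTh2009, Rmk 3.6.3 p.79] -/
theorem not_remark363 : ¬ temperedFrobenioid.Remark363 := fun h => not_isIsomorphismFull_hull h.1

/-- **The universal closure of the named fact `Remark363` over the typed data is REFUTED; `hFinv` is the exact
missing input of `Sec3Remark363.remark363_of_isSharp`**: there are Def 3.6 (i) data `T` (over the trivial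
vocabularies) with sharp tempered-Frobenioid interface `C` satisfying the typed Prop 3.4 (ii) structure
`Prop34Cnst` (for `cnst = 𝟭`) — hence `hP34Λ` — for which `F₀^Λ` is not inverse-closed and `C.Remark363`
fails. [cite: MochizukiEtTh2009, Rmk 3.6.3 p.79] -/
theorem hFinv_necessary :
    ∃ (T : RealifiedDivisorMonoids (D₀ := Discrete PUnit.{1}) Toy.monoidVocab)
      (C : TemperedFrobenioid T (Discrete PUnit.{1}) Toy.catVocab),
      (∀ A, IsSharp (C.divisorMonoid.obj (op A))) ∧ T.Prop34Cnst (𝟭 (Discrete PUnit.{1})) ∧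
        (¬ ∀ (Y : (Discrete PUnit.{1})ᵒᵖ) (b : T.BΛ.obj Y), b ∈ T.FΛ Y → ∃ b' ∈ T.FΛ Y, b' * b = 1) ∧
          ¬ C.Remark363 :=
  ⟨realified, temperedFrobenioid, isSharp_divisorMonoid, prop34Cnst, not_hFinv, not_remark363⟩

end ToyFinv

end Literature.AnabelianGeometry.EtaleTheta
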